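import Mathlib
import HarnessLib
import Summits.Ventures.LatticeQCDFlow.Exactness.RationalQuadraticSpline
import Summits.Ventures.LatticeQCDFlow.Exactness.PiecewiseGluing
import Summits.Ventures.LatticeQCDFlow.Exactness.CircularSplineJacobian

/-!
# The engine's circular rational-quadratic spline coupling on a U(1) link is exact: `K` bins, equal end slopes, Haar measure, the booked log-derivative

HONEST FRAMING: exact (Metropolis-corrected) sampling algorithms for lattice gauge theory;
figures of merit are autocorrelation/cost numbers at stated couplings and volumes; no
continuum-physics claim.

Venture `LatticeQCDFlow` (cell pub-lqcd), topic `Exactness`; FANOUT row 10 (`eng-equiv`, engine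
`latflow.equiv`, module `equiv/splines.py`: `rqs_forward` + `circ_spline_forward` with
`rqs_normalise(circular=True)`, release `equiv-0.4.1`; the same layer in `latflow.flows_jax`).
NEW WORK of the cell; nothing is cited as a fact; no number; no definition is introduced.  This
file only ASSEMBLES: the per-bin calculus is `RationalQuadraticSpline.lean`, the gluing across
knots is `PiecewiseGluing.lean`, the circle certificate is `CircularSplineJacobian.lean`
(over row 14's `CircleDegreeOneJacobian.lean`).  Printed counterparts, NAMED ONLY: Durkan et
al. 2019, Rezende et al. 2020, Kanwar et al. 2020.

## The object (the engine's parametrisation)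

`K ≥ 1` bins with widths `w k > 0`, heights `h k > 0` (`k < K`), knot slopes `d k > 0`
(`k ≤ K`) with the CIRCULAR constraint `d K = d 0`; knots `X 0 = 0`, `X (k+1) = X k + w k`,
`X K = 1` and `Y 0 = 0`, `Y (k+1) = Y k + h k`, `Y K = 1` (the engine's `_knots`: cumulative
sums with the last knot set to `1`).  The profile `g` is ANY real function that on each closed
bin `[X k, X (k+1)]` equals the bin's closed form
`Y k + h k · R_k((x − X k)/w k)`, `R_k(ξ) = (s ξ² + d_k ξ(1−ξ))/(s + (d_{k+1} + d_k − 2s) ξ(1−ξ))`,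
`s = h k / w k`, and `g'` ANY function that on each closed bin equals the engine's `dydx`
`(h k/w k) · R_k'(ξ)` — this is what `rqs_forward` returns (bin located, `ξ` clipped to `[0,1]`,
which is the identity inside the bin); the two closed forms of consecutive bins agree at the
shared knot in value (`Y (k+1)`) and slope (`d (k+1)`) by
`RationalQuadraticSpline.rqsBin_apply_right/left`, `rqsBin_deriv_right/left`, so the hypotheses
are consistent (`exists_circRQS_profile`).

## Content

* `circRQS_xi_mem` — inside bin `k`, `ξ = (x − X k)/w k ∈ [0,1]`; `circRQS_den_ne_zero`;
* `circRQS_hasDerivWithinAt_bin`, `circRQS_continuousOn_bin`, `circRQS_deriv_pos_bin` — per bin,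
  from `RationalQuadraticSpline`;
* `circRQS_hasDerivWithinAt`, `circRQS_continuousOn`, `circRQS_deriv_pos` — on `[0,1]`, by
  `PiecewiseGluing`; `circRQS_apply_left` (`g (X 0) = Y 0`), `circRQS_apply_right`
  (`g (X K) = Y K`), `circRQS_deriv_left` (`g' (X 0) = d 0`), `circRQS_deriv_right` (`g' (X K) = d K`);
* `exists_circRQS_profile` — NON-VACUITY: such `g`, `g'` exist (`PiecewiseGluing.exists_glued_fun`
  with the knot matching of `RationalQuadraticSpline`);
* **`hasJacobian_circle_circRQS`** — for any `F : ℝ/2πℤ → ℝ/2πℤ`, `J` with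
  `F ↑θ = ↑(2π·g(fract((θ + c)/(2π))) + c')`, `J ↑θ = ofReal (g'(fract((θ + c)/(2π))))`:
  `HasJacobian volume F J`.  The circular rational-quadratic spline layer of the engine, with the
  log-derivative it books, pushes the Haar measure of the link weighted by `J` to the Haar measure
  — the exactness hypothesis of `FlowPushforward` / `Theory2.hasJacobian_coupleFun` for this layer
  class, for every number of bins and all admissible parameters.

NOT here: the inverse pass (`rqs_inverse` is the exact inverse bin by bin:
`RationalQuadraticSpline.rqs_apply_inv` / `rqs_inv_apply`); measurability of the parameters in
the frozen links (row 31's coupling-layer theorem takes it as a hypothesis); SU(N).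
-/

noncomputable section

namespace Summit.Ventures.LatticeQCDFlow.Exactness

open Real Set Filter MeasureTheory Topology
open scoped ENNReal

section CircRQS

variable {K : ℕ} {w h d X Y : ℕ → ℝ} {g g' : ℝ → ℝ}

/-- Inside bin `k` (`X (k+1) = X k + w k`, `w k > 0`) the normalised abscissa lies in `[0,1]`. -/
theorem circRQS_xi_mem {k : ℕ} (hw : 0 < w k) (hXs : X (k + 1) = X k + w k) {x : ℝ}
    (hx : x ∈ Icc (X k) (X (k + 1))) : 0 ≤ (x - X k) / w k ∧ (x - X k) / w k ≤ 1 := by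
  refine ⟨div_nonneg (by linarith [hx.1]) hw.le, ?_⟩
  rw [div_le_one hw]
  linarith [hx.2]

/-- Inside bin `k` the denominator of the bin's closed form does not vanish. -/
theorem circRQS_den_ne_zero {k : ℕ} (hw : 0 < w k) (hh : 0 < h k) (hd0 : 0 < d k)
    (hd1 : 0 < d (k + 1)) (hXs : X (k + 1) = X k + w k) {x : ℝ} (hx : x ∈ Icc (X k) (X (k + 1))) :
    h k / w k + (d (k + 1) + d k - 2 * (h k / w k)) * ((x - X k) / w k * (1 - (x - X k) / w k))
      ≠ 0 :=
  have hξ := circRQS_xi_mem hw hXs hx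
  (rqs_den_pos (div_pos hh hw) hd0 hd1 hξ.1 hξ.2).ne'

/-- **Per bin, the profile has the booked within-derivative.** -/
theorem circRQS_hasDerivWithinAt_bin {k : ℕ} (hw : 0 < w k) (hh : 0 < h k) (hd0 : 0 < d k)
    (hd1 : 0 < d (k + 1)) (hXs : X (k + 1) = X k + w k)
    (hg : ∀ x ∈ Icc (X k) (X (k + 1)), g x = Y k + h k * ((h k / w k * ((x - X k) / w k) ^ 2 +
        d k * ((x - X k) / w k * (1 - (x - X k) / w k))) /
        (h k / w k + (d (k + 1) + d k - 2 * (h k / w k)) * ((x - X k) / w k * (1 - (x - X k) / w k)))))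
    (hg' : ∀ x ∈ Icc (X k) (X (k + 1)), g' x = h k / w k * (h k / w k * (d (k + 1) * ((x - X k) / w k) ^ 2
        + 2 * (h k / w k) * ((x - X k) / w k * (1 - (x - X k) / w k)) + d k * (1 - (x - X k) / w k) ^ 2) /
        (h k / w k + (d (k + 1) + d k - 2 * (h k / w k)) * ((x - X k) / w k * (1 - (x - X k) / w k))) ^ 2))
    {x : ℝ} (hx : x ∈ Icc (X k) (X (k + 1))) :
    HasDerivWithinAt g (g' x) (Icc (X k) (X (k + 1))) x := by
  have hD := (hasDerivAt_rqsBin (x₀ := X k) (y₀ := Y k) (w := w k) (h := h k) (d₀ := d k)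
    (d₁ := d (k + 1)) (circRQS_den_ne_zero hw hh hd0 hd1 hXs hx)).hasDerivWithinAt
    (s := Icc (X k) (X (k + 1)))
  rw [hg' x hx]
  exact hD.congr_of_mem (fun y hy => hg y hy) hx

/-- **Per bin, the booked derivative is continuous.** -/
theorem circRQS_continuousOn_bin {k : ℕ} (hw : 0 < w k) (hh : 0 < h k) (hd0 : 0 < d k)
    (hd1 : 0 < d (k + 1)) (hXs : X (k + 1) = X k + w k)
    (hg' : ∀ x ∈ Icc (X k) (X (k + 1)), g' x = h k / w k * (h k / w k * (d (k + 1) * ((x - X k) / w k) ^ 2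
        + 2 * (h k / w k) * ((x - X k) / w k * (1 - (x - X k) / w k)) + d k * (1 - (x - X k) / w k) ^ 2) /
        (h k / w k + (d (k + 1) + d k - 2 * (h k / w k)) * ((x - X k) / w k * (1 - (x - X k) / w k))) ^ 2)) :
    ContinuousOn g' (Icc (X k) (X (k + 1))) := by
  have hnum : Continuous fun x : ℝ => h k / w k * (d (k + 1) * ((x - X k) / w k) ^ 2
      + 2 * (h k / w k) * ((x - X k) / w k * (1 - (x - X k) / w k)) + d k * (1 - (x - X k) / w k) ^ 2) := by
    fun_prop
  have hden : Continuous fun x : ℝ =>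
      (h k / w k + (d (k + 1) + d k - 2 * (h k / w k)) * ((x - X k) / w k * (1 - (x - X k) / w k))) ^ 2 := by
    fun_prop
  refine ContinuousOn.congr (f := fun x : ℝ => h k / w k * (h k / w k * (d (k + 1) * ((x - X k) / w k) ^ 2
      + 2 * (h k / w k) * ((x - X k) / w k * (1 - (x - X k) / w k)) + d k * (1 - (x - X k) / w k) ^ 2) /
      (h k / w k + (d (k + 1) + d k - 2 * (h k / w k)) * ((x - X k) / w k * (1 - (x - X k) / w k))) ^ 2))
    (fun x hx => ?_) (fun x hx => hg' x hx)
  exact ((hnum.continuousAt.div hden.continuousAt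
    (pow_ne_zero 2 (circRQS_den_ne_zero hw hh hd0 hd1 hXs hx))).const_mul _).continuousWithinAt

/-- **Per bin, the booked derivative is positive.** -/
theorem circRQS_deriv_pos_bin {k : ℕ} (hw : 0 < w k) (hh : 0 < h k) (hd0 : 0 < d k)
    (hd1 : 0 < d (k + 1)) (hXs : X (k + 1) = X k + w k)
    (hg' : ∀ x ∈ Icc (X k) (X (k + 1)), g' x = h k / w k * (h k / w k * (d (k + 1) * ((x - X k) / w k) ^ 2
        + 2 * (h k / w k) * ((x - X k) / w k * (1 - (x - X k) / w k)) + d k * (1 - (x - X k) / w k) ^ 2) /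
        (h k / w k + (d (k + 1) + d k - 2 * (h k / w k)) * ((x - X k) / w k * (1 - (x - X k) / w k))) ^ 2))
    {x : ℝ} (hx : x ∈ Icc (X k) (X (k + 1))) : 0 < g' x := by
  have hξ := circRQS_xi_mem hw hXs hx
  rw [hg' x hx]
  exact mul_pos (div_pos hh hw) (rqsDeriv_pos (div_pos hh hw) hd0 hd1 hξ.1 hξ.2)

/-- The knots increase. -/
theorem circRQS_knots_mono (hw : ∀ k < K, 0 < w k) (hXs : ∀ k < K, X (k + 1) = X k + w k) :
    ∀ k < K, X k ≤ X (k + 1) := fun k hk => by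
  rw [hXs k hk]; exact (le_add_iff_nonneg_right _).2 (hw k hk).le

/-- **The profile is `C¹` on the whole knot range** (gluing across the interior knots). -/
theorem circRQS_hasDerivWithinAt (hw : ∀ k < K, 0 < w k) (hh : ∀ k < K, 0 < h k)
    (hd : ∀ k ≤ K, 0 < d k) (hXs : ∀ k < K, X (k + 1) = X k + w k)
    (hg : ∀ k < K, ∀ x ∈ Icc (X k) (X (k + 1)), g x = Y k + h k * ((h k / w k * ((x - X k) / w k) ^ 2
      + d k * ((x - X k) / w k * (1 - (x - X k) / w k))) /
      (h k / w k + (d (k + 1) + d k - 2 * (h k / w k)) * ((x - X k) / w k * (1 - (x - X k) / w k)))))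
    (hg' : ∀ k < K, ∀ x ∈ Icc (X k) (X (k + 1)), g' x = h k / w k * (h k / w k *
      (d (k + 1) * ((x - X k) / w k) ^ 2 + 2 * (h k / w k) * ((x - X k) / w k * (1 - (x - X k) / w k))
      + d k * (1 - (x - X k) / w k) ^ 2) /
      (h k / w k + (d (k + 1) + d k - 2 * (h k / w k)) * ((x - X k) / w k * (1 - (x - X k) / w k))) ^ 2))
    {x : ℝ} (hx : x ∈ Icc (X 0) (X K)) : HasDerivWithinAt g (g' x) (Icc (X 0) (X K)) x :=
  hasDerivWithinAt_Icc_glue K (circRQS_knots_mono hw hXs) (fun k hk _ hy =>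
    circRQS_hasDerivWithinAt_bin (hw k hk) (hh k hk) (hd k hk.le) (hd (k + 1) hk) (hXs k hk)
      (hg k hk) (hg' k hk) hy) x hx

/-- **The booked derivative is continuous on the knot range.** -/
theorem circRQS_continuousOn (hw : ∀ k < K, 0 < w k) (hh : ∀ k < K, 0 < h k)
    (hd : ∀ k ≤ K, 0 < d k) (hXs : ∀ k < K, X (k + 1) = X k + w k)
    (hg' : ∀ k < K, ∀ x ∈ Icc (X k) (X (k + 1)), g' x = h k / w k * (h k / w k *
      (d (k + 1) * ((x - X k) / w k) ^ 2 + 2 * (h k / w k) * ((x - X k) / w k * (1 - (x - X k) / w k))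
      + d k * (1 - (x - X k) / w k) ^ 2) /
      (h k / w k + (d (k + 1) + d k - 2 * (h k / w k)) * ((x - X k) / w k * (1 - (x - X k) / w k))) ^ 2)) :
    ContinuousOn g' (Icc (X 0) (X K)) :=
  continuousOn_Icc_glue K (circRQS_knots_mono hw hXs) fun k hk =>
    circRQS_continuousOn_bin (hw k hk) (hh k hk) (hd k hk.le) (hd (k + 1) hk) (hXs k hk) (hg' k hk)

/-- **The booked derivative is positive on the knot range** (`K ≥ 1`). -/
theorem circRQS_deriv_pos (hK : 0 < K) (hw : ∀ k < K, 0 < w k) (hh : ∀ k < K, 0 < h k)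
    (hd : ∀ k ≤ K, 0 < d k) (hXs : ∀ k < K, X (k + 1) = X k + w k)
    (hg' : ∀ k < K, ∀ x ∈ Icc (X k) (X (k + 1)), g' x = h k / w k * (h k / w k *
      (d (k + 1) * ((x - X k) / w k) ^ 2 + 2 * (h k / w k) * ((x - X k) / w k * (1 - (x - X k) / w k))
      + d k * (1 - (x - X k) / w k) ^ 2) /
      (h k / w k + (d (k + 1) + d k - 2 * (h k / w k)) * ((x - X k) / w k * (1 - (x - X k) / w k))) ^ 2))
    {x : ℝ} (hx : x ∈ Icc (X 0) (X K)) : 0 < g' x := by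
  obtain ⟨K', rfl⟩ := Nat.exists_eq_succ_of_ne_zero hK.ne'
  obtain ⟨k, hk, hmem⟩ := exists_bin_of_mem_Icc K' x hx
  exact circRQS_deriv_pos_bin (hw k hk) (hh k hk) (hd k hk.le) (hd (k + 1) hk) (hXs k hk) (hg' k hk)
    hmem

/-- `g (X 0) = Y 0` (left knot of bin `0`; `K ≥ 1`). -/
theorem circRQS_apply_left (hK : 0 < K) (hw : ∀ k < K, 0 < w k)
    (hXs : ∀ k < K, X (k + 1) = X k + w k)
    (hg : ∀ k < K, ∀ x ∈ Icc (X k) (X (k + 1)), g x = Y k + h k * ((h k / w k * ((x - X k) / w k) ^ 2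
      + d k * ((x - X k) / w k * (1 - (x - X k) / w k))) /
      (h k / w k + (d (k + 1) + d k - 2 * (h k / w k)) * ((x - X k) / w k * (1 - (x - X k) / w k))))) :
    g (X 0) = Y 0 := by
  have h0 : X 0 ∈ Icc (X 0) (X (0 + 1)) := ⟨le_rfl, circRQS_knots_mono hw hXs 0 hK⟩
  rw [hg 0 hK (X 0) h0]
  exact rqsBin_apply_left (X 0) (Y 0) (w 0) (h 0) (d 0) (d (0 + 1))

/-- `g (X K) = Y K` when `Y (k+1) = Y k + h k` (right knot of the last bin; `K ≥ 1`). -/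
theorem circRQS_apply_right (hK : 0 < K) (hw : ∀ k < K, 0 < w k) (hh : ∀ k < K, 0 < h k)
    (hXs : ∀ k < K, X (k + 1) = X k + w k) (hYs : ∀ k < K, Y (k + 1) = Y k + h k)
    (hg : ∀ k < K, ∀ x ∈ Icc (X k) (X (k + 1)), g x = Y k + h k * ((h k / w k * ((x - X k) / w k) ^ 2
      + d k * ((x - X k) / w k * (1 - (x - X k) / w k))) /
      (h k / w k + (d (k + 1) + d k - 2 * (h k / w k)) * ((x - X k) / w k * (1 - (x - X k) / w k))))) :
    g (X K) = Y K := by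
  obtain ⟨K', rfl⟩ := Nat.exists_eq_succ_of_ne_zero hK.ne'
  have hK' : K' < K' + 1 := Nat.lt_succ_self K'
  have hmem : X K' + w K' ∈ Icc (X K') (X (K' + 1)) := by
    rw [← hXs K' hK']; exact ⟨circRQS_knots_mono hw hXs K' hK', le_rfl⟩
  rw [hXs K' hK', hYs K' hK', hg K' hK' _ hmem]
  exact rqsBin_apply_right (hw K' hK').ne' (hh K' hK').ne' (X K') (Y K') (d K') (d (K' + 1))

/-- `g' (X 0) = d 0` (`K ≥ 1`). -/
theorem circRQS_deriv_left (hK : 0 < K) (hw : ∀ k < K, 0 < w k) (hh : ∀ k < K, 0 < h k)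
    (hXs : ∀ k < K, X (k + 1) = X k + w k)
    (hg' : ∀ k < K, ∀ x ∈ Icc (X k) (X (k + 1)), g' x = h k / w k * (h k / w k *
      (d (k + 1) * ((x - X k) / w k) ^ 2 + 2 * (h k / w k) * ((x - X k) / w k * (1 - (x - X k) / w k))
      + d k * (1 - (x - X k) / w k) ^ 2) /
      (h k / w k + (d (k + 1) + d k - 2 * (h k / w k)) * ((x - X k) / w k * (1 - (x - X k) / w k))) ^ 2)) :
    g' (X 0) = d 0 := by
  have h0 : X 0 ∈ Icc (X 0) (X (0 + 1)) := ⟨le_rfl, circRQS_knots_mono hw hXs 0 hK⟩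
  rw [hg' 0 hK (X 0) h0]
  exact rqsBin_deriv_left (hw 0 hK).ne' (hh 0 hK).ne' (X 0) (d 0) (d (0 + 1))

/-- `g' (X K) = d K` (`K ≥ 1`). -/
theorem circRQS_deriv_right (hK : 0 < K) (hw : ∀ k < K, 0 < w k) (hh : ∀ k < K, 0 < h k)
    (hXs : ∀ k < K, X (k + 1) = X k + w k)
    (hg' : ∀ k < K, ∀ x ∈ Icc (X k) (X (k + 1)), g' x = h k / w k * (h k / w k *
      (d (k + 1) * ((x - X k) / w k) ^ 2 + 2 * (h k / w k) * ((x - X k) / w k * (1 - (x - X k) / w k))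
      + d k * (1 - (x - X k) / w k) ^ 2) /
      (h k / w k + (d (k + 1) + d k - 2 * (h k / w k)) * ((x - X k) / w k * (1 - (x - X k) / w k))) ^ 2)) :
    g' (X K) = d K := by
  obtain ⟨K', rfl⟩ := Nat.exists_eq_succ_of_ne_zero hK.ne'
  have hK' : K' < K' + 1 := Nat.lt_succ_self K'
  have hmem : X K' + w K' ∈ Icc (X K') (X (K' + 1)) := by
    rw [← hXs K' hK']; exact ⟨circRQS_knots_mono hw hXs K' hK', le_rfl⟩
  rw [hXs K' hK', hg' K' hK' _ hmem]
  exact rqsBin_deriv_right (hw K' hK').ne' (hh K' hK').ne' (X K') (d K') (d (K' + 1))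

/-- **Non-vacuity**: for admissible parameters (`w, h > 0`, consecutive knots) there ARE
functions `g`, `g'` that agree with the bin closed forms on every closed bin — consecutive closed
forms agree at the shared knot in value (`Y (k+1)`) and slope (`d (k+1)`)
(`rqsBin_apply_right/left`, `rqsBin_deriv_right/left`), so `PiecewiseGluing.exists_glued_fun`
applies.  The engine's `rqs_forward` computes one such pair. -/
theorem exists_circRQS_profile (hw : ∀ k < K, 0 < w k) (hh : ∀ k < K, 0 < h k)
    (hXs : ∀ k < K, X (k + 1) = X k + w k) (hYs : ∀ k < K, Y (k + 1) = Y k + h k) :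
    ∃ g g' : ℝ → ℝ,
      (∀ k < K, ∀ x ∈ Icc (X k) (X (k + 1)), g x = Y k + h k * ((h k / w k * ((x - X k) / w k) ^ 2
      + d k * ((x - X k) / w k * (1 - (x - X k) / w k))) /
      (h k / w k + (d (k + 1) + d k - 2 * (h k / w k)) * ((x - X k) / w k * (1 - (x - X k) / w k))))) ∧
      (∀ k < K, ∀ x ∈ Icc (X k) (X (k + 1)), g' x = h k / w k * (h k / w k *
      (d (k + 1) * ((x - X k) / w k) ^ 2 + 2 * (h k / w k) * ((x - X k) / w k * (1 - (x - X k) / w k))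
      + d k * (1 - (x - X k) / w k) ^ 2) /
      (h k / w k + (d (k + 1) + d k - 2 * (h k / w k)) * ((x - X k) / w k * (1 - (x - X k) / w k))) ^ 2)) := by
  have hX : ∀ k < K, X k < X (k + 1) := fun k hk => by
    rw [hXs k hk]; exact lt_add_of_pos_right _ (hw k hk)
  obtain ⟨g, hg⟩ := exists_glued_fun (X := X) (φ := fun k x => Y k + h k * ((h k / w k * ((x - X k) / w k) ^ 2
      + d k * ((x - X k) / w k * (1 - (x - X k) / w k))) /
      (h k / w k + (d (k + 1) + d k - 2 * (h k / w k)) * ((x - X k) / w k * (1 - (x - X k) / w k))))) K hX (fun k hk => by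
    have hk' : k < K := Nat.lt_of_succ_lt hk
    rw [hXs k hk', rqsBin_apply_right (hw k hk').ne' (hh k hk').ne', rqsBin_apply_left, hYs k hk'])
  obtain ⟨g', hg'⟩ := exists_glued_fun (X := X) (φ := fun k x => h k / w k * (h k / w k *
      (d (k + 1) * ((x - X k) / w k) ^ 2 + 2 * (h k / w k) * ((x - X k) / w k * (1 - (x - X k) / w k))
      + d k * (1 - (x - X k) / w k) ^ 2) /
      (h k / w k + (d (k + 1) + d k - 2 * (h k / w k)) * ((x - X k) / w k * (1 - (x - X k) / w k))) ^ 2)) K hX (fun k hk => by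
    have hk' : k < K := Nat.lt_of_succ_lt hk
    rw [hXs k hk', rqsBin_deriv_right (hw k hk').ne' (hh k hk').ne',
      rqsBin_deriv_left (hw (k + 1) hk).ne' (hh (k + 1) hk).ne'])
  exact ⟨g, g', hg, hg'⟩

/-- **The engine's circular rational-quadratic spline layer on a U(1) link is exact.**  `K ≥ 1`
bins, widths/heights/slopes positive, knots `X 0 = 0, X (k+1) = X k + w k, X K = 1`,
`Y 0 = 0, Y (k+1) = Y k + h k, Y K = 1`, circular slopes `d K = d 0`; `g`, `g'` agree on every
closed bin with the bin's closed form and the booked `dydx`.  Then for all shifts `c, c'` and any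
`F : ℝ/2πℤ → ℝ/2πℤ`, `J` with `F ↑θ = ↑(2π·g(fract((θ + c)/(2π))) + c')`,
`J ↑θ = ofReal (g'(fract((θ + c)/(2π))))`: `HasJacobian volume F J`. -/
theorem hasJacobian_circle_circRQS [hT : Fact (0 < 2 * π)] (hK : 0 < K)
    (hw : ∀ k < K, 0 < w k) (hh : ∀ k < K, 0 < h k) (hd : ∀ k ≤ K, 0 < d k) (hcirc : d K = d 0)
    (hX0 : X 0 = 0) (hXs : ∀ k < K, X (k + 1) = X k + w k) (hXK : X K = 1)
    (hY0 : Y 0 = 0) (hYs : ∀ k < K, Y (k + 1) = Y k + h k) (hYK : Y K = 1)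
    (hg : ∀ k < K, ∀ x ∈ Icc (X k) (X (k + 1)), g x = Y k + h k * ((h k / w k * ((x - X k) / w k) ^ 2
      + d k * ((x - X k) / w k * (1 - (x - X k) / w k))) /
      (h k / w k + (d (k + 1) + d k - 2 * (h k / w k)) * ((x - X k) / w k * (1 - (x - X k) / w k)))))
    (hg' : ∀ k < K, ∀ x ∈ Icc (X k) (X (k + 1)), g' x = h k / w k * (h k / w k *
      (d (k + 1) * ((x - X k) / w k) ^ 2 + 2 * (h k / w k) * ((x - X k) / w k * (1 - (x - X k) / w k))
      + d k * (1 - (x - X k) / w k) ^ 2) /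
      (h k / w k + (d (k + 1) + d k - 2 * (h k / w k)) * ((x - X k) / w k * (1 - (x - X k) / w k))) ^ 2))
    (c c' : ℝ) {F : AddCircle (2 * π) → AddCircle (2 * π)}
    (hF : ∀ θ : ℝ, F θ = (((2 * π * g (Int.fract ((θ + c) / (2 * π))) + c' : ℝ)) : AddCircle (2 * π)))
    {J : AddCircle (2 * π) → ℝ≥0∞}
    (hJ : ∀ θ : ℝ, J θ = ENNReal.ofReal (g' (Int.fract ((θ + c) / (2 * π))))) :
    HasJacobian (volume : Measure (AddCircle (2 * π))) F J := by
  have hmem : ∀ u ∈ Icc (0 : ℝ) 1, u ∈ Icc (X 0) (X K) := fun u hu => by rwa [hX0, hXK]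
  have hderiv : ∀ u ∈ Icc (0 : ℝ) 1, HasDerivWithinAt g (g' u) (Icc 0 1) u := fun u hu => by
    have h := circRQS_hasDerivWithinAt hw hh hd hXs hg hg' (hmem u hu)
    rwa [hX0, hXK] at h
  have hcont : ContinuousOn g' (Icc 0 1) := by
    have h := circRQS_continuousOn hw hh hd hXs hg'
    rwa [hX0, hXK] at h
  have hpos : ∀ u ∈ Icc (0 : ℝ) 1, 0 < g' u := fun u hu =>
    circRQS_deriv_pos hK hw hh hd hXs hg' (hmem u hu)
  have hdeg : g 1 = g 0 + 1 := by
    have h1 := circRQS_apply_right hK hw hh hXs hYs hg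
    have h0 := circRQS_apply_left hK hw hXs hg
    rw [hXK, hYK] at h1
    rw [hX0, hY0] at h0
    rw [h1, h0, zero_add]
  have hslope : g' 1 = g' 0 := by
    have h1 := circRQS_deriv_right hK hw hh hXs hg'
    have h0 := circRQS_deriv_left hK hw hh hXs hg'
    rw [hXK] at h1
    rw [hX0] at h0
    rw [h1, h0, hcirc]
  exact hasJacobian_circle_circSpline hderiv hcont hpos hdeg hslope c c' hF hJ

end CircRQS

end Summit.Ventures.LatticeQCDFlow.Exactness
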